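import Summits.BirchSwinnertonDyer.BirchSwinnertonDyer.Theorems.ManinLocalTwoThreeEulerRemaindersSixtyFour
import Summits.BirchSwinnertonDyer.BirchSwinnertonDyer.Theorems.ManinLocalTwoThreeLigozatIdentitiesThirtyTwo
import HarnessLib

/-!
# The three `q`-limits (T1)₆₄, (T2)₆₄, (T3)₆₄ of the `η`-parametrisation of `X₀(64) → 64a1` — to STURM order

Cell bsd-f2-manin, route `ManinLocalTwoThree` (crux C2 `ManinOddAtFour` stmt-22967: `2² ∣ 64`; first genus-THREE level of the
domain), prover seat p3 gen 23.  Objects (all `η`-quotients; `E_δ = ∏(1 − q^{δn})`):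

  `X = η(16τ)⁶/(η(8τ)²η(32τ)⁴) = E₁₆⁶/(q²E₈²E₃₂⁴)` (the tree's `x`-coordinate of `X₀(32) → 32a1`; it is ALSO `x∘φ` for `64a1`),
  `y = η(4τ)²η(16τ)⁴/(η(8τ)²η(32τ)⁴) = E₄²E₁₆⁴/(q³E₈²E₃₂⁴)`,  `φ₆₄ = η(8τ)⁸/(η(4τ)²η(16τ)²) = qE₈⁸/(E₄²E₁₆²)`
  (the newform of `64a1 : y² = x³ − 4x`, `aₙ`: `1, 0, 0, 0, 2, 0, 0, 0, −3, …`).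

We prove, by the remainder calculus of `ManinLocalTwoThreeQRemainderCalculus` (Euler truncations to order `q⁸`, powers
pre-reduced, `ring`-checked witnesses):

* (T1)₆₄ `((2πi)⁻¹X′ + φ₆₄·2y)/q⁵ → 0` — `G₁ = E₁₆⁵(6T₁₆E₈E₃₂ − 2E₁₆E₈E₃₂ − 2T₈E₁₆E₃₂ − 4T₃₂E₈E₁₆) + 2E₈⁹E₁₆²E₃₂ ≡ 0 (mod q⁸)`
  (the SAME `G₁` as at level `32`: `φ₆₄·y = φ₃₂·Y₃₂`);
* (T2)₆₄ `((2πi)⁻¹y′ + φ₆₄(3X² − 4))/q⁵ → 0` — `G₂ = E₄³E₁₆⁵E₃₂³(2T₄E₁₆E₈E₃₂ + 4T₁₆E₄E₈E₃₂ − 3E₄E₁₆E₈E₃₂ − 2T₈E₄E₁₆E₃₂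
  − 4T₃₂E₄E₁₆E₈) + 3E₈⁷E₁₆¹² − 4q⁴E₈¹¹E₃₂⁸ ≡ 0 (mod q⁹)`, witness `S₂ = 15X³ + 30X⁷ + 9X¹¹`;
* (T3)₆₄ `X³ − 4X − y² → 0` — `E₁₆¹⁸ − 4q⁴E₈⁴E₁₆⁶E₃₂⁸ − E₄⁴E₈²E₁₆⁸E₃₂⁴ ≡ 0 (mod q⁸)`, witness `S₃ = −6 + 4X⁴ − X⁸`.

EXACTLY, with no limit: `φ₆₄·y = φ₃₂·Y₃₂` as functions (`phi64_mul_y64_eq`, Euler-function bookkeeping), so the level-`32`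
identity `X′ = −2πiφ₃₂·2Y₃₂` (tree: `LigozatIdentitiesThirtyTwo.deriv_X`) IS (I2a)₆₄ `X′ = −2πiφ₆₄·2y` (`deriv_X_sixtyFour`).

WHY ORDER `q⁵`: `dim S₂(Γ₀(64)) = g(X₀(64)) = 3` and the cuspidal Sturm bound at level `64` (`μ = 96`, `ν_∞ = 12`) kills a cusp form
with `a₁ = ⋯ = a₅ = 0`; so (T1)/(T2) to order `q⁵` are exactly what the level-`64` identity step (`X′ = −2πiφ₆₄·2y`,
`y′ = −2πiφ₆₄(3X² − 4)`, then `y² = X³ − 4X`, (S2)₆₄ `Λ(φ₆₄) ⊆ Λ(16, 0)` = Néron lattice of `64a1`, and the Néron squeeze) will consume;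
that step, the pinning of `D.f` at `64` (`U₂`, `T₅`, old candidate `φ₃₂` squeezed by (S2)₃₂) and minimality of `[0,0,0,∓4,0]` are NOT in
this file.  Pure `q`-series analysis; nothing here proves C2, Manin's conjecture or BSD; items stay OPEN.
[cite: Ligozat1975, Ch. 3] [cite: MartinOno1997, Thm. 2] [cite: DiamondShurman2005, Thm. 3.5.1]
-/

set_option autoImplicit false
set_option linter.dupNamespace false

noncomputable section

open Complex Filter Topology Set Asymptotics Polynomial
open UpperHalfPlane hiding I
open scoped Real Topology Manifold MatrixGroups
open Literature.NumberTheory.EllipticCurves Literature.NumberTheory.EllipticCurves.ModularForms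

namespace Summit.BirchSwinnertonDyer.BirchSwinnertonDyer.Theorems.ManinLocalTwoThree.EtaLimitsSixtyFour

open QRemainder EulerRemainders EulerRemaindersThirtyTwo EulerRemaindersSixtyFour

/-- **(T3)₆₄**: `X³ − 4X − y² → 0` at `i∞` for `X = η₁₆⁶/(η₈²η₃₂⁴)`, `y = η₄²η₁₆⁴/(η₈²η₃₂⁴)`
(`E₁₆¹⁸ − 4q⁴E₈⁴E₁₆⁶E₃₂⁸ − E₄⁴E₈²E₁₆⁸E₃₂⁴ ≡ 0 (mod q⁸)`). [folklore] -/
theorem tendsto_T3 :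
    Tendsto (fun τ : ℍ ↦ etaQuotient 32 (expFn [(8, -2), (16, 6), (32, -4)]) τ ^ 3
      - 4 * etaQuotient 32 (expFn [(8, -2), (16, 6), (32, -4)]) τ
      - etaQuotient 64 (expFn [(4, 2), (8, -2), (16, 4), (32, -4)]) τ ^ 2) atImInfty (𝓝 0) := by
  have hE4 := tendsto_eulerFn_four
  have hE8 := tendsto_eulerFn (δ := 8) (m := 7) (by norm_num)
  have hE16 := tendsto_eulerFn (δ := 16) (m := 7) (by norm_num)
  have hE32 := tendsto_eulerFn (δ := 32) (m := 7) (by norm_num)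
  have h1 := QRemainder.pow hE16 18
  have h2 := QRemainder.const_mul 4 (QRemainder.qParam_pow_mul 4 (QRemainder.mul (QRemainder.mul
    (QRemainder.pow hE8 4) (QRemainder.pow hE16 6)) (QRemainder.pow hE32 8)))
  have h3 := QRemainder.mul (QRemainder.mul (QRemainder.mul (QRemainder.pow hE4 4) (QRemainder.pow hE8 2))
    (QRemainder.pow hE16 8)) (QRemainder.pow hE32 4)
  have hG := QRemainder.reduce 0 (-6 + 4 * X ^ 4 - X ^ 8)
    (by simp only [map_ofNat]; ring) (QRemainder.sub (QRemainder.sub h1 h2) h3)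
  have hlim := (QRemainder.tendsto_div_pow 6 (by norm_num) hG).mul
    ((((isIntUnitQExp_eulerFn (by norm_num : 0 < 8)).tendsto_one.pow 6).mul
      ((isIntUnitQExp_eulerFn (by norm_num : 0 < 32)).tendsto_one.pow 12)).inv₀ (by norm_num))
  rw [zero_mul] at hlim
  refine hlim.congr fun τ ↦ ?_
  have hE4' := eulerFn_ne_zero (by norm_num : 0 < 4) τ
  have hE8' := eulerFn_ne_zero (by norm_num : 0 < 8) τ
  have hE16' := eulerFn_ne_zero (by norm_num : 0 < 16) τ
  have hE32' := eulerFn_ne_zero (by norm_num : 0 < 32) τ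
  have hq := qParam_ne_zero τ
  rw [X32_eq, y64_eq]
  field_simp

/-- **(T1)₆₄ to Sturm order**: `((2πi)⁻¹X′ + φ₆₄·2y)/q⁵ → 0` at `i∞` (`G₁ ≡ 0 (mod q⁸)`; `G₁` is the level-`32` polynomial, as
`φ₆₄·y = φ₃₂·Y₃₂`). [folklore] -/
theorem tendsto_T1 :
    Tendsto (fun τ : ℍ ↦ ((2 * π * I)⁻¹
      * deriv (etaQuotient 32 (expFn [(8, -2), (16, 6), (32, -4)]) ∘ ofComplex) τ
      + etaQuotient 64 (expFn [(4, -2), (8, 8), (16, -2)]) τ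
        * (2 * etaQuotient 64 (expFn [(4, 2), (8, -2), (16, 4), (32, -4)]) τ))
      / Function.Periodic.qParam 1 (τ : ℂ) ^ 5) atImInfty (𝓝 0) := by
  have h2pi : (2 * π * I : ℂ) ≠ 0 := by simp [Real.pi_ne_zero, I_ne_zero]
  have hE8 := tendsto_eulerFn (δ := 8) (m := 7) (by norm_num)
  have hE16 := tendsto_eulerFn (δ := 16) (m := 7) (by norm_num)
  have hE32 := tendsto_eulerFn (δ := 32) (m := 7) (by norm_num)
  have hT8 := QRemainder.congr_poly (P' := 0) (by rw [mul_zero])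
    (QRemainder.const_mul (2 * π * I)⁻¹ (tendsto_deriv_eulerFn (δ := 8) (m := 7) (by norm_num)))
  have hT16 := QRemainder.congr_poly (P' := 0) (by rw [mul_zero])
    (QRemainder.const_mul (2 * π * I)⁻¹ (tendsto_deriv_eulerFn (δ := 16) (m := 7) (by norm_num)))
  have hT32 := QRemainder.congr_poly (P' := 0) (by rw [mul_zero])
    (QRemainder.const_mul (2 * π * I)⁻¹ (tendsto_deriv_eulerFn (δ := 32) (m := 7) (by norm_num)))
  -- `G₁ = E₁₆⁵(6T₁₆E₈E₃₂ − 2E₁₆E₈E₃₂ − 2E₁₆T₈E₃₂ − 4E₁₆E₈T₃₂) + 2E₈⁹E₁₆²E₃₂ ≡ 0 (mod q⁸)`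
  have hA := QRemainder.mul (QRemainder.mul (QRemainder.const_mul 6 hT16) hE8) hE32
  have hB := QRemainder.mul (QRemainder.mul (QRemainder.const_mul 2 hE16) hE8) hE32
  have hC := QRemainder.mul (QRemainder.mul (QRemainder.const_mul 2 hE16) hT8) hE32
  have hD := QRemainder.mul (QRemainder.mul (QRemainder.const_mul 4 hE16) hE8) hT32
  have h1 := QRemainder.mul (QRemainder.pow hE16 5)
    (QRemainder.sub (QRemainder.sub (QRemainder.sub hA hB) hC) hD)
  have h2 := QRemainder.mul (QRemainder.mul (QRemainder.const_mul 2 (QRemainder.pow hE8 9))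
    (QRemainder.pow hE16 2)) hE32
  have hG := QRemainder.reduce 0 0 (by simp only [map_ofNat]; ring) (QRemainder.add h1 h2)
  have hlim := (QRemainder.tendsto_div_pow 7 (by norm_num) hG).mul
    ((((isIntUnitQExp_eulerFn (by norm_num : 0 < 8)).tendsto_one.pow 3).mul
      ((isIntUnitQExp_eulerFn (by norm_num : 0 < 32)).tendsto_one.pow 5)).inv₀ (by norm_num))
  rw [zero_mul] at hlim
  refine hlim.congr fun τ ↦ ?_
  have hE4' := eulerFn_ne_zero (by norm_num : 0 < 4) τ
  have hE8' := eulerFn_ne_zero (by norm_num : 0 < 8) τ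
  have hE16' := eulerFn_ne_zero (by norm_num : 0 < 16) τ
  have hE32' := eulerFn_ne_zero (by norm_num : 0 < 32) τ
  have hq := qParam_ne_zero τ
  rw [deriv_X32, y64_eq, phi64_eq]
  field_simp

/-- **(T2)₆₄ to Sturm order**: `((2πi)⁻¹y′ + φ₆₄(3X² − 4))/q⁵ → 0` at `i∞` (`G₂ ≡ 0 (mod q⁹)`, powers pre-reduced:
`E₄³ ≡ 1 − 3q⁴`, `E₈⁷ ≡ 1 − 7q⁸`, `E₈¹¹ ≡ 1 − 11q⁸`; witness `S₂ = 15X³ + 30X⁷ + 9X¹¹`). [folklore] -/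
theorem tendsto_T2 :
    Tendsto (fun τ : ℍ ↦ ((2 * π * I)⁻¹
      * deriv (etaQuotient 64 (expFn [(4, 2), (8, -2), (16, 4), (32, -4)]) ∘ ofComplex) τ
      + etaQuotient 64 (expFn [(4, -2), (8, 8), (16, -2)]) τ
        * (3 * etaQuotient 32 (expFn [(8, -2), (16, 6), (32, -4)]) τ ^ 2 - 4))
      / Function.Periodic.qParam 1 (τ : ℂ) ^ 5) atImInfty (𝓝 0) := by
  have h2pi : (2 * π * I : ℂ) ≠ 0 := by simp [Real.pi_ne_zero, I_ne_zero]
  have hE4 := tendsto_eulerFn_four_eight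
  have hE8 := tendsto_eulerFn_eight_eight
  have hE16 := tendsto_eulerFn (δ := 16) (m := 8) (by norm_num)
  have hE32 := tendsto_eulerFn (δ := 32) (m := 8) (by norm_num)
  have hT4 := QRemainder.congr_poly (P' := -4 * X ^ 4 - 8 * X ^ 8)
    (by rw [← mul_assoc, ← map_mul, inv_mul_cancel₀ h2pi, map_one, one_mul])
    (QRemainder.const_mul (2 * π * I)⁻¹ tendsto_deriv_eulerFn_four_eight)
  have hT8 := QRemainder.congr_poly (P' := -8 * X ^ 8)
    (by rw [← mul_assoc, ← map_mul, inv_mul_cancel₀ h2pi, map_one, one_mul])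
    (QRemainder.const_mul (2 * π * I)⁻¹ tendsto_deriv_eulerFn_eight_eight)
  have hT16 := QRemainder.congr_poly (P' := 0) (by rw [mul_zero])
    (QRemainder.const_mul (2 * π * I)⁻¹ (tendsto_deriv_eulerFn (δ := 16) (m := 8) (by norm_num)))
  have hT32 := QRemainder.congr_poly (P' := 0) (by rw [mul_zero])
    (QRemainder.const_mul (2 * π * I)⁻¹ (tendsto_deriv_eulerFn (δ := 32) (m := 8) (by norm_num)))
  -- pre-reduced powers (mod `q⁹`)
  have hE4c := QRemainder.reduce (1 - 3 * X ^ 4) (5 * X ^ 3 - 3 * X ^ 11 - X ^ 15)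
    (by ring) (QRemainder.pow hE4 3)
  have hE8s := QRemainder.reduce (1 - 7 * X ^ 8)
    (21 * X ^ 7 - 35 * X ^ 15 + 35 * X ^ 23 - 21 * X ^ 31 + 7 * X ^ 39 - X ^ 47)
    (by ring) (QRemainder.pow hE8 7)
  have hE8e := QRemainder.reduce (1 - 11 * X ^ 8)
    (55 * X ^ 7 - 165 * X ^ 15 + 330 * X ^ 23 - 462 * X ^ 31 + 462 * X ^ 39 - 330 * X ^ 47
      + 165 * X ^ 55 - 55 * X ^ 63 + 11 * X ^ 71 - X ^ 79)
    (by ring) (QRemainder.pow hE8 11)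
  -- `G₂ = E₄³E₁₆⁵E₃₂³(2T₄E₁₆E₈E₃₂ + 4T₁₆E₄E₈E₃₂ − 3E₄E₁₆E₈E₃₂ − 2T₈E₄E₁₆E₃₂ − 4T₃₂E₄E₁₆E₈) + 3E₈⁷E₁₆¹² − 4q⁴E₈¹¹E₃₂⁸`
  have hA := QRemainder.mul (QRemainder.mul (QRemainder.mul (QRemainder.const_mul 2 hT4) hE16) hE8) hE32
  have hB := QRemainder.mul (QRemainder.mul (QRemainder.mul (QRemainder.const_mul 4 hT16) hE4) hE8) hE32
  have hC := QRemainder.mul (QRemainder.mul (QRemainder.mul (QRemainder.const_mul 3 hE4) hE16) hE8) hE32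
  have hD := QRemainder.mul (QRemainder.mul (QRemainder.mul (QRemainder.const_mul 2 hT8) hE4) hE16) hE32
  have hE := QRemainder.mul (QRemainder.mul (QRemainder.mul (QRemainder.const_mul 4 hT32) hE4) hE16) hE8
  have h1 := QRemainder.mul (QRemainder.mul (QRemainder.mul hE4c (QRemainder.pow hE16 5)) (QRemainder.pow hE32 3))
    (QRemainder.sub (QRemainder.sub (QRemainder.sub (QRemainder.add hA hB) hC) hD) hE)
  have h2 := QRemainder.mul (QRemainder.const_mul 3 hE8s) (QRemainder.pow hE16 12)
  have h3 := QRemainder.const_mul 4 (QRemainder.qParam_pow_mul 4 (QRemainder.mul hE8e (QRemainder.pow hE32 8)))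
  have hG := QRemainder.reduce 0 (15 * X ^ 3 + 30 * X ^ 7 + 9 * X ^ 11)
    (by simp only [map_ofNat]; ring) (QRemainder.sub (QRemainder.add h1 h2) h3)
  have hlim := (QRemainder.tendsto_div_pow 8 (by norm_num) hG).mul
    ((((isIntUnitQExp_eulerFn (by norm_num : 0 < 4)).tendsto_one.pow 2).mul
      ((((isIntUnitQExp_eulerFn (by norm_num : 0 < 16)).tendsto_one.pow 2).mul
      ((isIntUnitQExp_eulerFn (by norm_num : 0 < 8)).tendsto_one.pow 3)).mul
      ((isIntUnitQExp_eulerFn (by norm_num : 0 < 32)).tendsto_one.pow 8))).inv₀ (by norm_num))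
  rw [zero_mul] at hlim
  refine hlim.congr fun τ ↦ ?_
  have hE4' := eulerFn_ne_zero (by norm_num : 0 < 4) τ
  have hE8' := eulerFn_ne_zero (by norm_num : 0 < 8) τ
  have hE16' := eulerFn_ne_zero (by norm_num : 0 < 16) τ
  have hE32' := eulerFn_ne_zero (by norm_num : 0 < 32) τ
  have hq := qParam_ne_zero τ
  rw [deriv_y64, X32_eq, phi64_eq]
  field_simp
  ring

/-! ## (I2a)₆₄ exactly: `φ₆₄·y = φ₃₂·Y₃₂`, hence `X′ = −2πi φ₆₄·2y` from the level-`32` identity -/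

/-- **`φ₆₄·y₆₄ = φ₃₂·Y₃₂`** on `ℍ`: `(qE₈⁸/(E₄²E₁₆²))·(E₄²E₁₆⁴/(q³E₈²E₃₂⁴)) = (qE₄²E₈²)·(E₈⁴E₁₆²/(q³E₄²E₃₂⁴)) = E₈⁶E₁₆²/(q²E₃₂⁴)`
(as `η`-products both are `η₈⁶η₁₆²/η₃₂⁴`). [folklore] -/
theorem phi64_mul_y64_eq (τ : ℍ) :
    etaQuotient 64 (expFn [(4, -2), (8, 8), (16, -2)]) τ
        * etaQuotient 64 (expFn [(4, 2), (8, -2), (16, 4), (32, -4)]) τ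
      = cuspFormEtaProductThirtyTwo τ * etaQuotient 32 (expFn [(4, -2), (8, 4), (16, 2), (32, -4)]) τ := by
  have hE4' := eulerFn_ne_zero (by norm_num : 0 < 4) τ
  have hE8' := eulerFn_ne_zero (by norm_num : 0 < 8) τ
  have hE16' := eulerFn_ne_zero (by norm_num : 0 < 16) τ
  have hE32' := eulerFn_ne_zero (by norm_num : 0 < 32) τ
  have hq := qParam_ne_zero τ
  rw [phi64_eq, y64_eq, etaProductThirtyTwo_eq, Y32_eq]
  field_simp

/-- **(I2a)₆₄ exactly: `X′ = −2πi φ₆₄ · 2y₆₄`** on `ℍ` — the level-`32` identity `X′ = −2πiφ₃₂·2Y₃₂`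
(`LigozatIdentitiesThirtyTwo.deriv_X`) rewritten through `φ₆₄·y₆₄ = φ₃₂·Y₃₂`. [cite: Ligozat1975, Ch. 3] -/
theorem deriv_X_sixtyFour (τ : ℍ) :
    deriv (etaQuotient 32 (expFn [(8, -2), (16, 6), (32, -4)]) ∘ ofComplex) τ
      = -(2 * π * I * etaQuotient 64 (expFn [(4, -2), (8, 8), (16, -2)]) τ)
          * (2 * etaQuotient 64 (expFn [(4, 2), (8, -2), (16, 4), (32, -4)]) τ) := by
  rw [LigozatIdentitiesThirtyTwo.deriv_X τ]
  have h := phi64_mul_y64_eq τ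
  linear_combination (2 * (2 * π * I)) * h

end Summit.BirchSwinnertonDyer.BirchSwinnertonDyer.Theorems.ManinLocalTwoThree.EtaLimitsSixtyFour

end
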